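import Mathlib
import HarnessLib
import Summits.Ventures.LatticeQCDFlow.Scaling.GiniMeanDifferenceVarianceBounds
import Summits.Ventures.LatticeQCDFlow.Scaling.WilsonTransferAcceptanceFloor
import Summits.Ventures.LatticeQCDFlow.TrivializingMaps.U1WilsonFisherZero
import Summits.Ventures.LatticeQCDFlow.TrivializingMaps.WilsonSU2FisherZeroRadius
import Summits.Ventures.LatticeQCDFlow.TrivializingMaps.WilsonMeasureTrivializingMap

/-!
# LatticeQCDFlow / Scaling — the strong-coupling / coupling-transfer slope of an exact Wilson sampler
# is at most `√(Var(S)/3)`; at a trained coupling `β₀` that is `√(ψ″(β₀)/3)` (the heat capacity), and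
# the global transfer floor reads `acc(β₀ → β) ≥ 1 − D(μ_{β₀}‖μ_β) − |β − β₀|·√(ψ″(β₀)/3)`

HONEST FRAMING: exact (Metropolis-corrected) sampling algorithms for lattice gauge theory;
figures of merit are autocorrelation/cost numbers at stated couplings and volumes; no
continuum-physics claim.

Venture `LatticeQCDFlow` (cell pub-lqcd), topic `Scaling`; FANOUT row 3 (`s0-u1-a`, S0-B
implementation A, GEN-18).  NEW WORK of the cell (assembly), not a published result; NO definition is
introduced.  Parents: GEN-18's `Scaling/GiniMeanDifferenceVarianceBounds` (Glasser:
`½E|T − T′| ≤ √(Var T/3)` for `T` bounded below) and `Scaling/WilsonTransferAcceptanceFloor`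
(`exp(−D − |β−β₀|·s(β₀)) ≤ acc(β₀ → β)`); lean-2's `TrivializingMaps/SpecificHeatAnyGroup`
(`ψ″(t) = Var_{μ_t}(S_W)`, `ψ = cgf(−S_W)` under `D[U]` — REUSED, not restated).

* **`wilsonIdentityFlow_slope_le_sqrt_variance_div_three`** — for every compact `G`, continuous `ρ`,
  `d`, `L` and reference probability law `μ`: `½∫∫|S(U) − S(U′)| dμ dμ ≤ √(Var_μ(S)/3)` — the strong-
  coupling acceptance slope of the untrained sampler of `Scaling/IdentityFlowAcceptanceStrongCoupling`
  (GEN-17 (D)) is at most a `1/√3` standard deviation of the action (sharper than (D)'s `1/√2`);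
* **`wilsonIdentityFlow_slope_le_sqrt_card_mul_haarVariance`** — at `μ = D[U]` (the cell's untrained
  torus sampler), `L ≥ 2`: slope `≤ √(#plaq·Var_Haar(Re tr ρ)/3)` (lean-2's
  `PlaquetteDecorrelation.variance_wilsonAction_eq_card_mul`), an explicit `O(√V)` ceiling for the
  actual torus theory; **`u1Torus_identityFlow_slope_le_sqrt_card_div_six`** — U(1): `≤ √(#plaq/6)`
  (lean-2's `variance_re_haar_circle`), the same ceiling as the factorised model's;
  **`su2Torus_identityFlow_slope_le_sqrt_card_div_three`** — SU(2) (defining representation): `≤ √(#plaq/3)`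
  (lean-2's `wilson_su2_variance_eq`);
* **`wilsonTransfer_slope_le_sqrt_specificHeat_div_three`** — at `μ = μ_{β₀}`:
  `s(β₀) ≤ √(ψ″(β₀)/3)` (second countable `G`);
* **`wilsonTransfer_exp_specificHeat_le_meanAccept`**, **`wilsonTransfer_one_sub_specificHeat_le_meanAccept`**
  — for ALL `β₀, β`: `exp(−D(μ_{β₀}‖μ_β) − |β − β₀|·√(ψ″(β₀)/3)) ≤ acc(β₀ → β)` and the linear form.

Reading (value-free): the first-order transfer penalty per unit coupling is controlled by the heat
capacity at the training coupling, so the window of target couplings at which a perfectly trained flow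
keeps a given acceptance has width `O(1/√ψ″(β₀)) = O(1/√(|Λ_p|·c(β₀)))` — lean-2's
`CouplingLadderLawAnyGroup` reaches the same scaling for replica-exchange ladders; here the constant is
the sharper `1/√3`.  NOT CLAIMED: lower bounds for the transfer slope; any value at the cell's `(β, L)`.
-/

noncomputable section

namespace Summit.Ventures.LatticeQCDFlow.Theory2

open MeasureTheory Real Set ProbabilityTheory Filter Topology InformationTheory
open Literature.MathematicalPhysics.QuantumFieldTheory
open Literature.MathematicalPhysics.QuantumFieldTheory.Luscher2010 (trivialMeasure)
open Summit.Ventures.LatticeQCDFlow.TrivializingMaps (iteratedDeriv_two_cgf_eq_variance_wilsonMeasure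
  variance_wilsonAction_eq_card_mul variance_re_haar_circle)
open Literature.MathematicalPhysics.QuantumLattice (u1Rep continuous_u1Rep fundamentalRep continuous_fundamentalRep)

section AnyReference

variable {d L N : ℕ} [NeZero L] {G : Type*} [Group G] [TopologicalSpace G] [IsTopologicalGroup G]
  [CompactSpace G] [MeasurableSpace G] [BorelSpace G] (ρ : G →* Matrix (Fin N) (Fin N) ℂ)
  (μ : Measure (GaugeConfig d L G)) [IsProbabilityMeasure μ]

/-- **THE SLOPE OF AN EXACT WILSON SAMPLER IS AT MOST `√(Var_μ(S)/3)`**: for every compact `G`,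
continuous `ρ`, `d`, `L` and reference probability law `μ`, `½∫∫ |S(U) − S(U′)| dμ dμ ≤ √(Var_μ(S)/3)`
(the action of a finite torus is bounded, so the Glasser bound of
`Scaling/GiniMeanDifferenceVarianceBounds` applies). [ours] -/
theorem wilsonIdentityFlow_slope_le_sqrt_variance_div_three (hρ : Continuous ρ) :
    1 / 2 * ∫ U, ∫ U', |wilsonAction ρ U - wilsonAction ρ U'| ∂μ ∂μ
      ≤ Real.sqrt (variance (fun U => wilsonAction ρ U) μ / 3) := by
  obtain ⟨B, hB⟩ := exists_abs_wilsonAction_le (d := d) (L := L) ρ hρ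
  have hC : ∀ U : GaugeConfig d L G, -B - 1 < wilsonAction ρ U := fun U => by
    have h := (abs_le.1 (hB U)).1; linarith
  have h2 : MemLp (fun U : GaugeConfig d L G => wilsonAction ρ U) 2 μ :=
    MemLp.of_bound (WilsonRP.measurable_wilsonAction ρ hρ).aestronglyMeasurable B
      (ae_of_all _ fun U => by rw [Real.norm_eq_abs]; exact hB U)
  exact half_integral_abs_sub_le_sqrt_variance_div_three (WilsonRP.measurable_wilsonAction ρ hρ) h2 hC

end AnyReference

section Transfer

variable {d L N : ℕ} [NeZero L] {G : Type*} [Group G] [TopologicalSpace G] [IsTopologicalGroup G]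
  [CompactSpace G] [MeasurableSpace G] [BorelSpace G] [SecondCountableTopology G]
  (ρ : G →* Matrix (Fin N) (Fin N) ℂ)

/-- **THE UNTRAINED TORUS SAMPLER (product-Haar proposals `D[U]`), every compact `G`, continuous `ρ`,
`d`, `L ≥ 2`: strong-coupling slope `≤ √(#plaquettes · Var_Haar(Re tr ρ)/3)`** — an explicit `O(√V)`
ceiling for the ACTUAL torus theory (lean-2's `PlaquetteDecorrelation.variance_wilsonAction_eq_card_mul`:
`Var_{D[U]}(S_W) = #plaq·Var_Haar(Re tr ρ)`, plaquette traces being pairwise uncorrelated at `β = 0`).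
For U(1) (`Var_Haar(cos) = ½`) this is `√(#plaq/6)`, the same ceiling as the factorised model's
(`Scaling/U1IdentityFlowSlopeVolumeLaw`). [ours] -/
theorem wilsonIdentityFlow_slope_le_sqrt_card_mul_haarVariance (hρ : Continuous ρ) (hL : 2 ≤ L) :
    1 / 2 * ∫ U, ∫ U', |wilsonAction ρ U - wilsonAction ρ U'|
        ∂(trivialMeasure G d L) ∂(trivialMeasure G d L)
      ≤ Real.sqrt (Fintype.card (Plaquette d L)
          * variance (fun g => (ρ g).trace.re) (haarProbability G) / 3) := by
  haveI : IsProbabilityMeasure (trivialMeasure G d L) := by unfold trivialMeasure; infer_instance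
  rw [← variance_wilsonAction_eq_card_mul ρ hρ hL]
  exact wilsonIdentityFlow_slope_le_sqrt_variance_div_three ρ (trivialMeasure G d L) hρ

omit ρ in
/-- **THE UNTRAINED SU(2) TORUS SAMPLER (defining representation): strong-coupling slope
`≤ √(#plaquettes/3)`** (`Var_Haar(Re tr) = 1` on `SU(2)`: lean-2's `wilson_su2_variance_eq` with the
dictionary `ambWilsonAction_coeConfig`). [ours] -/
theorem su2Torus_identityFlow_slope_le_sqrt_card_div_three (hL : 2 ≤ L) :
    1 / 2 * ∫ U, ∫ U', |wilsonAction (fundamentalRep (Fin 2)) U - wilsonAction (fundamentalRep (Fin 2)) U'|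
        ∂(trivialMeasure (Matrix.specialUnitaryGroup (Fin 2) ℂ) d L)
        ∂(trivialMeasure (Matrix.specialUnitaryGroup (Fin 2) ℂ) d L)
      ≤ Real.sqrt (Fintype.card (Plaquette d L) / 3) := by
  haveI : IsProbabilityMeasure (trivialMeasure (Matrix.specialUnitaryGroup (Fin 2) ℂ) d L) := by
    unfold trivialMeasure; infer_instance
  have h := wilsonIdentityFlow_slope_le_sqrt_variance_div_three (d := d) (L := L) (fundamentalRep (Fin 2))
    (trivialMeasure (Matrix.specialUnitaryGroup (Fin 2) ℂ) d L) (continuous_fundamentalRep (Fin 2))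
  have hv : variance (fun U => wilsonAction (d := d) (L := L) (fundamentalRep (Fin 2)) U)
      (trivialMeasure (Matrix.specialUnitaryGroup (Fin 2) ℂ) d L) = Fintype.card (Plaquette d L) := by
    have h2 := Summit.Ventures.LatticeQCDFlow.TrivializingMaps.wilson_su2_variance_eq (d := d) hL
    simp only [Summit.Ventures.LatticeQCDFlow.TrivializingMaps.StrongCoupling.ambWilsonAction_coeConfig] at h2
    exact h2
  rw [hv] at h
  exact h

omit ρ in
/-- **THE UNTRAINED 2-d (any `d`) U(1) TORUS SAMPLER: strong-coupling slope `≤ √(#plaquettes/6)`** — the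
actual torus theory of the cell's S0-B rung obeys the same `√(V/6)` ceiling as the factorised model
(`Var_Haar(Re z) = ½` on `U(1)`, lean-2's `variance_re_haar_circle`). [ours] -/
theorem u1Torus_identityFlow_slope_le_sqrt_card_div_six [MeasurableSpace Circle] [BorelSpace Circle]
    (hL : 2 ≤ L) :
    1 / 2 * ∫ U, ∫ U', |wilsonAction u1Rep U - wilsonAction u1Rep U'|
        ∂(trivialMeasure Circle d L) ∂(trivialMeasure Circle d L)
      ≤ Real.sqrt (Fintype.card (Plaquette d L) / 6) := by
  have h := wilsonIdentityFlow_slope_le_sqrt_card_mul_haarVariance (d := d) (L := L) u1Rep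
    continuous_u1Rep hL
  rw [variance_re_haar_circle] at h
  calc _ ≤ _ := h
    _ = Real.sqrt (Fintype.card (Plaquette d L) / 6) := by congr 1; ring


/-- **`s(β₀) ≤ √(ψ″(β₀)/3)`**: the coupling-transfer slope of a flow perfectly trained at `β₀` is at
most the square root of a third of the heat capacity (lean-2's `ψ″ = Var`). [ours] -/
theorem wilsonTransfer_slope_le_sqrt_specificHeat_div_three (hρ : Continuous ρ) (β₀ : ℝ) :
    1 / 2 * ∫ U, ∫ U', |wilsonAction ρ U - wilsonAction ρ U'|
        ∂(wilsonMeasure (d := d) (L := L) ρ β₀) ∂(wilsonMeasure (d := d) (L := L) ρ β₀)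
      ≤ Real.sqrt (iteratedDeriv 2 (cgf (fun U => -wilsonAction ρ U) (trivialMeasure G d L)) β₀ / 3) := by
  haveI := isProbabilityMeasure_wilsonMeasure (d := d) (L := L) (G := G) ρ hρ β₀
  rw [iteratedDeriv_two_cgf_eq_variance_wilsonMeasure ρ hρ β₀]
  exact wilsonIdentityFlow_slope_le_sqrt_variance_div_three ρ (wilsonMeasure (d := d) (L := L) ρ β₀) hρ

/-- **GLOBAL TRANSFER FLOOR WITH THE HEAT CAPACITY**: for every `β₀, β`,
`exp(−D(μ_{β₀}‖μ_β) − |β − β₀|·√(ψ″(β₀)/3)) ≤ acc(β₀ → β)`. [ours] -/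
theorem wilsonTransfer_exp_specificHeat_le_meanAccept (hρ : Continuous ρ) (β₀ β : ℝ) :
    Real.exp (-(klDiv (wilsonMeasure (d := d) (L := L) ρ β₀) (wilsonMeasure (d := d) (L := L) ρ β)).toReal
        - |β - β₀| * Real.sqrt (iteratedDeriv 2
            (cgf (fun U => -wilsonAction ρ U) (trivialMeasure G d L)) β₀ / 3))
      ≤ ∫ U, ∫ U',
        min (Real.exp (-(β - β₀) * wilsonAction ρ U)
            / ∫ V, Real.exp (-(β - β₀) * wilsonAction ρ V) ∂(wilsonMeasure (d := d) (L := L) ρ β₀))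
          (Real.exp (-(β - β₀) * wilsonAction ρ U')
            / ∫ V, Real.exp (-(β - β₀) * wilsonAction ρ V) ∂(wilsonMeasure (d := d) (L := L) ρ β₀))
        ∂(wilsonMeasure (d := d) (L := L) ρ β₀) ∂(wilsonMeasure (d := d) (L := L) ρ β₀) := by
  refine le_trans (Real.exp_le_exp.2 ?_) (wilsonTransfer_exp_le_meanAccept ρ hρ β₀ β)
  have hs := wilsonTransfer_slope_le_sqrt_specificHeat_div_three (d := d) (L := L) ρ hρ β₀
  have habs : 0 ≤ |β - β₀| := abs_nonneg _
  nlinarith [mul_le_mul_of_nonneg_left hs habs]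

/-- **LINEAR FORM**: `1 − D(μ_{β₀}‖μ_β) − |β − β₀|·√(ψ″(β₀)/3) ≤ acc(β₀ → β)` for every `β₀, β`. [ours] -/
theorem wilsonTransfer_one_sub_specificHeat_le_meanAccept (hρ : Continuous ρ) (β₀ β : ℝ) :
    1 - (klDiv (wilsonMeasure (d := d) (L := L) ρ β₀) (wilsonMeasure (d := d) (L := L) ρ β)).toReal
        - |β - β₀| * Real.sqrt (iteratedDeriv 2
            (cgf (fun U => -wilsonAction ρ U) (trivialMeasure G d L)) β₀ / 3)
      ≤ ∫ U, ∫ U',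
        min (Real.exp (-(β - β₀) * wilsonAction ρ U)
            / ∫ V, Real.exp (-(β - β₀) * wilsonAction ρ V) ∂(wilsonMeasure (d := d) (L := L) ρ β₀))
          (Real.exp (-(β - β₀) * wilsonAction ρ U')
            / ∫ V, Real.exp (-(β - β₀) * wilsonAction ρ V) ∂(wilsonMeasure (d := d) (L := L) ρ β₀))
        ∂(wilsonMeasure (d := d) (L := L) ρ β₀) ∂(wilsonMeasure (d := d) (L := L) ρ β₀) := by
  refine le_trans ?_ (wilsonTransfer_exp_specificHeat_le_meanAccept ρ hρ β₀ β)
  have h := Real.add_one_le_exp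
    (-(klDiv (wilsonMeasure (d := d) (L := L) ρ β₀) (wilsonMeasure (d := d) (L := L) ρ β)).toReal
        - |β - β₀| * Real.sqrt (iteratedDeriv 2
            (cgf (fun U => -wilsonAction ρ U) (trivialMeasure G d L)) β₀ / 3))
  linarith

end Transfer

end Summit.Ventures.LatticeQCDFlow.Theory2
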